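import Literature.AlgebraicTopology.Homotopy.SimplexBallHomeomorph
import Literature.AlgebraicTopology.Homotopy.BoxBoundaryExtension
import Literature.AlgebraicTopology.SingularHomology.StdSimplexFaces
import Mathlib.Topology.UnitInterval
import HarnessLib

/-!
# Filling prisms over simplices: homotopies prescribed on the faces extend to the simplex

Topic `Literature/AlgebraicTopology/Homotopy`. The two extension steps of the Eilenberg
deformation of the singular complex of a highly connected space (Spanier, *Algebraic Topology*
(1966), Ch. 7 §4, Lemma 7 / Thm. 8 — conditions (a) `P(σ)(z,0) = σ(z)` and (c)
`P(σ) ∘ (eⁱ × 1) = P(σ⁽ⁱ⁾)` of Lemma 7 are the two conclusions below; Hatcher, *Algebraic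
Topology* (2002), Prop. 0.16 and Lemma 4.7 for the geometric content), phrased for the tree's
standard simplices `Δ^q = StdStdSimplex q = stdSimplex ℝ (Fin (q + 1))`, their cofaces `stdFace`
(`Literature/AlgebraicTopology/SingularHomology/StdSimplexFaces.lean`) and the prism `Δ^q × I`:

* `SimplexPrism.exists_fill`: given a map `σ : Δ^{q+1} → X` and, for each face `i`, a homotopy
  `Fᵢ : Δ^q × I → X` starting at `σ ∘ δᵢ`, the `Fᵢ` agreeing where faces overlap, there is a
  homotopy `G : Δ^{q+1} × I → X` starting at `σ` and restricting to `Fᵢ` on the `i`-th face (the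
  prism retracts onto its bottom and sides: `WhiteheadCW.boxFill`, transported along the
  homeomorphism `(Δ, ∂Δ) ≅ (D, S)` of `SimplexBallHomeomorph.lean`);
* `SimplexPrism.exists_fill_const`: if moreover every `Fᵢ` ends at the constant map `x₀`, `X` is
  path connected and `π_{q+1}(X, x) = 0` for all `x`, then `G` can be taken to end at the
  constant map `x₀` as well (the data on the whole boundary of the prism — a `(q+1)`-sphere —
  extends: `BoxExt.exists_extension`).

Also: `SimplexPrism.dropCoord` (delete a vanishing coordinate; a pointwise inverse of `stdFace`
on the facet) and the ambient transport maps `fwd`/`bwd` between `Δ^q` and the sup-norm ball.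
Everything is proved; no named facts.

## References

* E. H. Spanier, *Algebraic Topology*, McGraw-Hill 1966 / Springer 1981, Ch. 7 §4, Lemma 7, Thm. 8. [Spanier1981]
* A. Hatcher, *Algebraic Topology*, CUP (2002), Prop. 0.16; §4.1 Lemma 4.7 (p. 348).
  [HatcherAT2002]
-/

noncomputable section

open Set Metric Topology Function
open scoped Topology unitInterval

namespace Literature.AlgebraicTopology.Homotopy

namespace SimplexPrism

attribute [local instance] Classical.propDecidable

open Literature.AlgebraicTopology.SingularHomology

variable {q : ℕ}

/-! ### Deleting a vanishing coordinate -/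

/-- Dropping the `i`-th coordinate of a point of `Δ^{q+1}` whose `i`-th coordinate vanishes
gives a point of `Δ^q`. [folklore] -/
def dropCoord (i : Fin (q + 2)) (u : StdSimplex (q + 1)) (hu : u i = 0) : StdSimplex q :=
  ⟨fun j => u (i.succAbove j), fun j => u.2.1 _, by
    have h := u.2.2
    rw [Fin.sum_univ_succAbove _ i] at h
    change u i + ∑ j, u (i.succAbove j) = 1 at h
    rw [hu, zero_add] at h
    exact h⟩

/-- Coordinates of `dropCoord`. [folklore] -/
@[simp] theorem dropCoord_apply (i : Fin (q + 2)) (u : StdSimplex (q + 1)) (hu : u i = 0) (j : Fin (q + 1)) :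
    dropCoord i u hu j = u (i.succAbove j) := rfl

/-- `δᵢ (dropCoord i u) = u`. [folklore] -/
theorem stdFace_dropCoord (i : Fin (q + 2)) (u : StdSimplex (q + 1)) (hu : u i = 0) :
    stdFace i (dropCoord i u hu) = u := by
  apply stdSimplex.ext
  funext k
  by_cases hk : k = i
  · subst hk; rw [stdFace_apply_self, hu]
  · obtain ⟨j, rfl⟩ := Fin.exists_succAbove_eq hk
    rw [stdFace_apply_succAbove, dropCoord_apply]

/-- `dropCoord i (δᵢ t) = t`. [folklore] -/
theorem dropCoord_stdFace (i : Fin (q + 2)) (t : StdSimplex q) :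
    dropCoord i (stdFace i t) (stdFace_apply_self i t) = t := by
  apply stdSimplex.ext
  funext j
  rw [dropCoord_apply, stdFace_apply_succAbove]

/-- `dropCoord` is continuous in `u` (on the facet). [folklore] -/
theorem continuous_dropCoord_comp (i : Fin (q + 2)) :
    Continuous fun u : {u : StdSimplex (q + 1) // u i = 0} => dropCoord i u.1 u.2 := by
  refine Continuous.subtype_mk (continuous_pi fun j => ?_) _
  exact ((continuous_apply (i.succAbove j)).comp continuous_subtype_val).comp continuous_subtype_val

/-! ### The ambient transport maps `Δ^q ↔ D^q` -/

open SimplexBall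

variable (q) in
/-- The forward transport `ℝ^{q+1} → ℝ^q`, equal to `toBall` on the simplex. [folklore] -/
def fwd (t : Fin (q + 1) → ℝ) : Fin q → ℝ := rescale q (chart q t)

variable (q) in
/-- The backward transport `ℝ^q → ℝ^{q+1}`, equal to `toBall.symm` on the ball. [folklore] -/
def bwd (y : Fin q → ℝ) : Fin (q + 1) → ℝ := unchart q ((rescale q).symm y)

/-- `fwd` is continuous. [folklore] -/
@[fun_prop] theorem continuous_fwd : Continuous (fwd q) :=
  (rescale q).continuous.comp (continuous_chart q)

/-- `bwd` is continuous. [folklore] -/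
@[fun_prop] theorem continuous_bwd : Continuous (bwd q) :=
  (continuous_unchart q).comp (rescale q).symm.continuous

/-- `fwd` agrees with `toBall`. [folklore] -/
theorem fwd_eq_toBall (t : StdSimplex q) : fwd q t = (toBall q t : Fin q → ℝ) := rfl

/-- `bwd ∘ fwd = id` on the simplex. [folklore] -/
theorem bwd_fwd (t : StdSimplex q) : bwd q (fwd q t) = t := by
  show unchart q ((rescale q).symm (rescale q (chart q t.1))) = t.1
  rw [Homeomorph.symm_apply_apply]
  exact unchart_chart q t.2.2

/-- `fwd` of a point of the simplex is in the closed ball. [folklore] -/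
theorem fwd_mem_closedBall (t : StdSimplex q) : fwd q t ∈ closedBall (0 : Fin q → ℝ) 1 := by
  rw [fwd_eq_toBall]; exact (toBall q t).2

/-- `fwd` of a boundary point of the simplex is on the sphere. [folklore] -/
theorem fwd_mem_sphere {t : StdSimplex q} (h : ∃ i, t i = 0) : fwd q t ∈ sphere (0 : Fin q → ℝ) 1 := by
  rw [fwd_eq_toBall]; exact (toBall_mem_sphere_iff q t).2 h

/-- `bwd` of a point of the closed ball is in the simplex. [folklore] -/
theorem bwd_mem {y : Fin q → ℝ} (hy : y ∈ closedBall (0 : Fin q → ℝ) 1) :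
    bwd q y ∈ stdSimplex ℝ (Fin (q + 1)) :=
  ((toBall q).symm ⟨y, hy⟩).2

/-- `fwd ∘ bwd = id` on the closed ball. [folklore] -/
theorem fwd_bwd {y : Fin q → ℝ} (hy : y ∈ closedBall (0 : Fin q → ℝ) 1) : fwd q (bwd q y) = y := by
  have h := (toBall q).apply_symm_apply ⟨y, hy⟩
  exact congrArg Subtype.val h

/-- A point of the sphere comes from the boundary of the simplex. [folklore] -/
theorem exists_bwd_eq_zero {y : Fin q → ℝ} (hy : y ∈ sphere (0 : Fin q → ℝ) 1) :
    ∃ i, bwd q y i = 0 :=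
  (exists_toBall_symm_apply_eq_zero_iff q ⟨y, sphere_subset_closedBall hy⟩).2 hy

/-! ### The boundary data of a prism assembled from face data -/

variable {X : Type*} [TopologicalSpace X]

/-- The side data of the prism: on the facet `{uᵢ = 0} × [0, 1]` (first such `i`) the face
homotopy `Fᵢ`, read through `dropCoord`; junk elsewhere. [folklore] -/
def sideData (F : Fin (q + 2) → C(StdSimplex q × I, X)) (x₀ : X) (p : (Fin (q + 2) → ℝ) × ℝ) : X :=
  if h : p.1 ∈ stdSimplex ℝ (Fin (q + 2)) ∧ ∃ i, p.1 i = 0 then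
    F (zeroIdx (⟨p.1, h.1⟩ : StdSimplex (q + 1)))
      (dropCoord (zeroIdx (⟨p.1, h.1⟩ : StdSimplex (q + 1))) ⟨p.1, h.1⟩ (apply_zeroIdx (y := ⟨p.1, h.1⟩) h.2),
        projIcc 0 1 zero_le_one p.2)
  else x₀

/-- Compatibility of face data: the face homotopies agree where the faces overlap. [folklore] -/
def Compatible (F : Fin (q + 2) → C(StdSimplex q × I, X)) : Prop :=
  ∀ (i j : Fin (q + 2)) (t t' : StdSimplex q) (s : I), stdFace i t = stdFace j t' → F i (t, s) = F j (t', s)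

/-- On the `i`-th facet the side data is `Fᵢ` (by compatibility, whichever facet index was used
to define it). [folklore] -/
theorem sideData_stdFace {F : Fin (q + 2) → C(StdSimplex q × I, X)} (hF : Compatible F) (x₀ : X)
    (i : Fin (q + 2)) (t : StdSimplex q) (s : I) :
    sideData F x₀ ((stdFace i t : StdSimplex (q + 1)) , (s : ℝ)) = F i (t, s) := by
  have h : ((stdFace i t : StdSimplex (q + 1)) : Fin (q + 2) → ℝ) ∈ stdSimplex ℝ (Fin (q + 2)) ∧
      ∃ j, (stdFace i t : StdSimplex (q + 1)) j = 0 := ⟨(stdFace i t).2, i, stdFace_apply_self i t⟩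
  unfold sideData
  rw [dif_pos h, projIcc_val zero_le_one s]
  refine hF _ _ _ _ s ?_
  rw [stdFace_dropCoord]
  exact Subtype.ext rfl

/-- The side data is continuous on `∂Δ × ℝ` (it is `Fᵢ` on each closed facet). [folklore] -/
theorem continuousOn_sideData {F : Fin (q + 2) → C(StdSimplex q × I, X)} (hF : Compatible F) (x₀ : X) :
    ContinuousOn (sideData F x₀)
      {p : (Fin (q + 2) → ℝ) × ℝ | p.1 ∈ stdSimplex ℝ (Fin (q + 2)) ∧ ∃ i, p.1 i = 0} := by
  have heq : {p : (Fin (q + 2) → ℝ) × ℝ | p.1 ∈ stdSimplex ℝ (Fin (q + 2)) ∧ ∃ i, p.1 i = 0} =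
      ⋃ i : Fin (q + 2), {p | p.1 ∈ stdSimplex ℝ (Fin (q + 2)) ∧ p.1 i = 0} := by
    ext p; simp only [mem_setOf_eq, mem_iUnion]; constructor
    · rintro ⟨h1, i, hi⟩; exact ⟨i, h1, hi⟩
    · rintro ⟨i, h1, hi⟩; exact ⟨h1, i, hi⟩
  rw [heq]
  refine LocallyFinite.continuousOn_iUnion (locallyFinite_of_finite _) (fun i => ?_) (fun i => ?_)
  · exact (IsClosed.preimage continuous_fst (isClosed_stdSimplex ℝ (Fin (q + 2)))).inter
      (isClosed_eq ((continuous_apply i).comp continuous_fst) continuous_const)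
  · -- on the `i`-th facet: `F i` read through `dropCoord`
    rw [continuousOn_iff_continuous_restrict]
    have hc : Continuous fun p : {p : (Fin (q + 2) → ℝ) × ℝ | p.1 ∈ stdSimplex ℝ (Fin (q + 2)) ∧ p.1 i = 0} =>
        F i (dropCoord i (⟨p.1.1, p.2.1⟩ : StdSimplex (q + 1)) p.2.2, projIcc 0 1 zero_le_one p.1.2) := by
      refine (F i).continuous.comp (Continuous.prodMk ?_ (continuous_projIcc.comp (continuous_snd.comp continuous_subtype_val)))
      have h1 : Continuous fun p : {p : (Fin (q + 2) → ℝ) × ℝ | p.1 ∈ stdSimplex ℝ (Fin (q + 2)) ∧ p.1 i = 0} =>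
          (⟨⟨p.1.1, p.2.1⟩, p.2.2⟩ : {u : StdSimplex (q + 1) // u i = 0}) :=
        ((continuous_fst.comp continuous_subtype_val).subtype_mk _).subtype_mk _
      exact (continuous_dropCoord_comp i).comp h1
    refine hc.congr fun p => ?_
    obtain ⟨⟨u, s⟩, hu, hui⟩ := p
    have hmem : stdFace i (dropCoord i ⟨u, hu⟩ hui) = stdFace (zeroIdx (⟨u, hu⟩ : StdSimplex (q + 1)))
        (dropCoord (zeroIdx (⟨u, hu⟩ : StdSimplex (q + 1))) ⟨u, hu⟩
          (apply_zeroIdx (y := ⟨u, hu⟩) ⟨i, hui⟩)) := by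
      rw [stdFace_dropCoord, stdFace_dropCoord]
    show F i _ = sideData F x₀ (u, s)
    unfold sideData
    rw [dif_pos ⟨hu, i, hui⟩]
    exact hF _ _ _ _ _ hmem

/-- The side data on a point of a facet, through any of its vanishing coordinates. [folklore] -/
theorem sideData_of_apply_eq_zero {F : Fin (q + 2) → C(StdSimplex q × I, X)} (hF : Compatible F) (x₀ : X)
    (u : StdSimplex (q + 1)) {i : Fin (q + 2)} (hu : u i = 0) (s : I) :
    sideData F x₀ ((u : Fin (q + 2) → ℝ), (s : ℝ)) = F i (dropCoord i u hu, s) := by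
  have h := sideData_stdFace hF x₀ i (dropCoord i u hu) s
  rwa [stdFace_dropCoord] at h

/-! ### Filling the prism -/

section Fill

variable (f : C(StdSimplex (q + 1), X)) (F : Fin (q + 2) → C(StdSimplex q × I, X)) (x₀ : X)

/-- The bottom data in the box model: `f` read through `bwd` (junk off the ball). [folklore] -/
def botData (y : Fin (q + 1) → ℝ) : X :=
  if hy : y ∈ closedBall (0 : Fin (q + 1) → ℝ) 1 then f ⟨bwd (q + 1) y, bwd_mem hy⟩ else x₀

/-- The bottom data is continuous on the closed ball. [folklore] -/
theorem continuousOn_botData : ContinuousOn (botData f x₀) (closedBall (0 : Fin (q + 1) → ℝ) 1) := by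
  rw [continuousOn_iff_continuous_restrict]
  have hc : Continuous fun y : closedBall (0 : Fin (q + 1) → ℝ) 1 => f ((toBall (q + 1)).symm y) :=
    f.continuous.comp (toBall (q + 1)).symm.continuous
  refine hc.congr fun y => ?_
  show f ((toBall (q + 1)).symm y) = botData f x₀ y
  unfold botData
  rw [dif_pos y.2]
  rfl

/-- On the ball the bottom data is `f ∘ bwd`. [folklore] -/
theorem botData_of_mem {y : Fin (q + 1) → ℝ} (hy : y ∈ closedBall (0 : Fin (q + 1) → ℝ) 1) :
    botData f x₀ y = f ⟨bwd (q + 1) y, bwd_mem hy⟩ := by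
  unfold botData; rw [dif_pos hy]

/-- The bottom data at `fwd t` is `f t`. [folklore] -/
theorem botData_fwd (t : StdSimplex (q + 1)) : botData f x₀ (fwd (q + 1) t) = f t := by
  rw [botData_of_mem f x₀ (fwd_mem_closedBall t)]
  congr 1
  exact Subtype.ext (bwd_fwd t)

/-- The side data in the box model: `sideData` read through `bwd`. [folklore] -/
def sideData' (p : (Fin (q + 1) → ℝ) × ℝ) : X := sideData F x₀ (bwd (q + 1) p.1, p.2)

/-- The box-model side data is continuous on `S × ℝ`. [folklore] -/
theorem continuousOn_sideData' (hF : Compatible F) :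
    ContinuousOn (sideData' F x₀) (sphere (0 : Fin (q + 1) → ℝ) 1 ×ˢ (univ : Set ℝ)) := by
  refine (continuousOn_sideData hF x₀).comp (by fun_prop) ?_
  rintro ⟨y, s⟩ ⟨hy, -⟩
  exact ⟨bwd_mem (sphere_subset_closedBall hy), exists_bwd_eq_zero hy⟩

/-- On the rim the side data starts at the bottom data. [folklore] -/
theorem sideData'_zero (hF : Compatible F) (hbot : ∀ i t, F i (t, 0) = f (stdFace i t))
    {w : Fin (q + 1) → ℝ} (hw : w ∈ sphere (0 : Fin (q + 1) → ℝ) 1) :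
    sideData' F x₀ (w, 0) = botData f x₀ w := by
  obtain ⟨i, hi⟩ := exists_bwd_eq_zero hw
  set u : StdSimplex (q + 1) := ⟨bwd (q + 1) w, bwd_mem (sphere_subset_closedBall hw)⟩ with hu
  have hui : u i = 0 := hi
  have h := sideData_of_apply_eq_zero hF x₀ u hui 0
  show sideData F x₀ (bwd (q + 1) w, 0) = _
  rw [show ((bwd (q + 1) w, 0) : (Fin (q + 2) → ℝ) × ℝ) = ((u : Fin (q + 2) → ℝ), ((0 : I) : ℝ)) from rfl, h,
    hbot, stdFace_dropCoord, botData_of_mem f x₀ (sphere_subset_closedBall hw)]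

/-- On `fwd` of the `i`-th face the side data is `Fᵢ`. [folklore] -/
theorem sideData'_fwd_stdFace (hF : Compatible F) (i : Fin (q + 2)) (t : StdSimplex q) (s : I) :
    sideData' F x₀ (fwd (q + 1) (stdFace i t), (s : ℝ)) = F i (t, s) := by
  show sideData F x₀ (bwd (q + 1) (fwd (q + 1) (stdFace i t)), (s : ℝ)) = _
  rw [bwd_fwd]
  exact sideData_stdFace hF x₀ i t s

/-- **Face homotopies extend over the simplex.** Given `f : Δ^{q+1} → X` and compatible face
homotopies `Fᵢ : Δ^q × I → X` with `Fᵢ(·, 0) = f ∘ δᵢ`, there is `G : Δ^{q+1} × I → X` with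
`G(·, 0) = f` and `G ∘ (δᵢ × id) = Fᵢ` (the prism retracts onto its bottom and sides; Hatcher
2002, Prop. 0.16, here through `WhiteheadCW.boxFill` and the homeomorphism `Δ ≅ D` of
`SimplexBallHomeomorph.lean`). [cite: Spanier1981, Ch. 7 §4, Lemma 7] [cite: HatcherAT2002, Prop. 0.16 and §4.1 Lemma 4.7] -/
theorem exists_fill (hF : Compatible F) (hbot : ∀ i t, F i (t, 0) = f (stdFace i t)) :
    ∃ G : C(StdSimplex (q + 1) × I, X), (∀ t, G (t, 0) = f t) ∧ ∀ i t s, G (stdFace i t, s) = F i (t, s) := by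
  let x₀ : X := f (Classical.arbitrary (StdSimplex (q + 1)))
  set G' := WhiteheadCW.boxFill 1 (botData f x₀) (sideData' F x₀) with hG'
  have hG'c : ContinuousOn G' (closedBall (0 : Fin (q + 1) → ℝ) 1 ×ˢ Icc (0 : ℝ) 1) :=
    WhiteheadCW.boxFill_continuousOn one_pos le_rfl (continuousOn_botData f x₀)
      ((continuousOn_sideData' F x₀ hF).mono (prod_mono le_rfl (subset_univ _)))
      (fun w hw => sideData'_zero f F x₀ hF hbot hw)
  have hmem : ∀ z : StdSimplex (q + 1) × I, (fwd (q + 1) z.1, (z.2 : ℝ)) ∈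
      closedBall (0 : Fin (q + 1) → ℝ) 1 ×ˢ Icc (0 : ℝ) 1 := fun z => ⟨fwd_mem_closedBall z.1, z.2.2⟩
  refine ⟨⟨fun z => G' (fwd (q + 1) z.1, (z.2 : ℝ)), hG'c.comp_continuous (by fun_prop) hmem⟩, ?_, ?_⟩
  · intro t
    show G' (fwd (q + 1) t, ((0 : I) : ℝ)) = f t
    rw [show ((0 : I) : ℝ) = 0 from rfl, hG', WhiteheadCW.boxFill_bottom one_pos (fwd_mem_closedBall t)]
    exact botData_fwd f x₀ t
  · intro i t s
    show G' (fwd (q + 1) (stdFace i t), (s : ℝ)) = F i (t, s)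
    rw [hG', WhiteheadCW.boxFill_side one_pos (fun w hw => sideData'_zero f F x₀ hF hbot hw)
      (fwd_mem_sphere ⟨i, stdFace_apply_self i t⟩) ⟨s.2.1, s.2.2⟩]
    exact sideData'_fwd_stdFace F x₀ hF i t s

/-- The full boundary data in the box model (with top `x₀`). [folklore] -/
def bdryData (p : (Fin (q + 1) → ℝ) × ℝ) : X :=
  if p.1 ∈ sphere (0 : Fin (q + 1) → ℝ) 1 then sideData' F x₀ p
  else if p.2 ≤ 1 / 2 then botData f x₀ p.1 else x₀

/-- The full boundary data is continuous on the box boundary. [folklore] -/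
theorem continuousOn_bdryData (hF : Compatible F) (hbot : ∀ i t, F i (t, 0) = f (stdFace i t))
    (htop : ∀ i t, F i (t, 1) = x₀) : ContinuousOn (bdryData f F x₀) (BoxExt.boxBoundary (q + 1)) := by
  have h1 : BoxExt.boxBoundary (q + 1) = (closedBall (0 : Fin (q + 1) → ℝ) 1 ×ˢ {(0 : ℝ)}) ∪
      ((closedBall (0 : Fin (q + 1) → ℝ) 1 ×ˢ {(1 : ℝ)}) ∪ (sphere (0 : Fin (q + 1) → ℝ) 1 ×ˢ Icc (0 : ℝ) 1)) := by
    ext p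
    rw [BoxExt.mem_boxBoundary]
    simp only [mem_union, mem_prod, mem_singleton_iff]
    tauto
  rw [h1]
  refine ContinuousOn.union_of_isClosed ?_ (ContinuousOn.union_of_isClosed ?_ ?_
    (isClosed_closedBall.prod isClosed_singleton) (isClosed_sphere.prod isClosed_Icc))
    (isClosed_closedBall.prod isClosed_singleton)
    ((isClosed_closedBall.prod isClosed_singleton).union (isClosed_sphere.prod isClosed_Icc))
  · -- bottom: `botData`
    have hc : ContinuousOn (fun p : (Fin (q + 1) → ℝ) × ℝ => botData f x₀ p.1)
        (closedBall (0 : Fin (q + 1) → ℝ) 1 ×ˢ {(0 : ℝ)}) :=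
      (continuousOn_botData f x₀).comp continuousOn_fst fun p hp => hp.1
    refine hc.congr fun p hp => ?_
    obtain ⟨w, t⟩ := p
    obtain ⟨hw, ht⟩ := hp
    have ht0 : t = 0 := ht
    subst ht0
    unfold bdryData
    by_cases hws : w ∈ sphere (0 : Fin (q + 1) → ℝ) 1
    · rw [if_pos hws]; exact sideData'_zero f F x₀ hF hbot hws
    · rw [if_neg hws, if_pos (by norm_num)]
  · -- top: constant `x₀`
    refine (continuousOn_const (c := x₀)).congr fun p hp => ?_
    obtain ⟨w, t⟩ := p
    obtain ⟨hw, ht⟩ := hp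
    have ht1 : t = 1 := ht
    subst ht1
    unfold bdryData
    by_cases hws : w ∈ sphere (0 : Fin (q + 1) → ℝ) 1
    · rw [if_pos hws]
      obtain ⟨i, hi⟩ := exists_bwd_eq_zero hws
      set u : StdSimplex (q + 1) := ⟨bwd (q + 1) w, bwd_mem (sphere_subset_closedBall hws)⟩ with hu
      have hui : u i = 0 := hi
      have h := sideData_of_apply_eq_zero hF x₀ u hui 1
      show sideData F x₀ (bwd (q + 1) w, 1) = x₀
      rw [show ((bwd (q + 1) w, 1) : (Fin (q + 2) → ℝ) × ℝ) = ((u : Fin (q + 2) → ℝ), ((1 : I) : ℝ)) from rfl,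
        h, htop]
    · rw [if_neg hws, if_neg (by norm_num)]
  · -- sides: `sideData'`
    refine ((continuousOn_sideData' F x₀ hF).mono (prod_mono le_rfl (subset_univ _))).congr
      fun p hp => ?_
    unfold bdryData
    rw [if_pos hp.1]

/-- **Face homotopies ending at a constant extend to a homotopy ending at the constant, when
`π_{q+1}` vanishes.** As `exists_fill`, with moreover `Fᵢ(·, 1) = x₀` for all `i`, `X` path
connected and `π_{q+1}(X, x) = 0` for every `x`: then `G` can be chosen with `G(·, 1) = x₀`
(the data on the boundary of the prism `Δ^{q+1} × I`, a `(q+1)`-sphere, extends: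
`BoxExt.exists_extension`). This is the step of the Eilenberg deformation in the dimensions
below the connectivity (Spanier 1966, Ch. 7 §4, Lemma 7 / Thm. 8).
[cite: Spanier1981, Ch. 7 §4, Lemma 7] [cite: HatcherAT2002, Prop. 0.16 and §4.1 Lemma 4.7] -/
theorem exists_fill_const [PathConnectedSpace X] (hπ : ∀ x : X, Subsingleton (π_ (q + 1) X x))
    (hF : Compatible F) (hbot : ∀ i t, F i (t, 0) = f (stdFace i t)) (htop : ∀ i t, F i (t, 1) = x₀) :
    ∃ G : C(StdSimplex (q + 1) × I, X), (∀ t, G (t, 0) = f t) ∧ (∀ t, G (t, 1) = x₀) ∧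
      ∀ i t s, G (stdFace i t, s) = F i (t, s) := by
  obtain ⟨Φ, hΦc, hΦ⟩ := BoxExt.exists_extension (m := q + 1) (fun _ => hπ)
    (continuousOn_bdryData f F x₀ hF hbot htop)
  have hmem : ∀ z : StdSimplex (q + 1) × I, (fwd (q + 1) z.1, (z.2 : ℝ)) ∈
      closedBall (0 : Fin (q + 1) → ℝ) 1 ×ˢ Icc (0 : ℝ) 1 := fun z => ⟨fwd_mem_closedBall z.1, z.2.2⟩
  refine ⟨⟨fun z => Φ (fwd (q + 1) z.1, (z.2 : ℝ)), hΦc.comp_continuous (by fun_prop) hmem⟩, ?_, ?_, ?_⟩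
  · intro t
    show Φ (fwd (q + 1) t, ((0 : I) : ℝ)) = f t
    have hb : (fwd (q + 1) t, ((0 : I) : ℝ)) ∈ BoxExt.boxBoundary (q + 1) :=
      BoxExt.mem_boxBoundary.2 (Or.inl ⟨fwd_mem_closedBall t, Or.inl rfl⟩)
    rw [hΦ hb]
    unfold bdryData
    by_cases hws : fwd (q + 1) t ∈ sphere (0 : Fin (q + 1) → ℝ) 1
    · rw [if_pos hws]
      exact (sideData'_zero f F x₀ hF hbot hws).trans (botData_fwd f x₀ t)
    · rw [if_neg hws, if_pos (show ((0 : I) : ℝ) ≤ 1 / 2 by norm_num)]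
      exact botData_fwd f x₀ t
  · intro t
    show Φ (fwd (q + 1) t, ((1 : I) : ℝ)) = x₀
    have hb : (fwd (q + 1) t, ((1 : I) : ℝ)) ∈ BoxExt.boxBoundary (q + 1) :=
      BoxExt.mem_boxBoundary.2 (Or.inl ⟨fwd_mem_closedBall t, Or.inr rfl⟩)
    rw [hΦ hb]
    unfold bdryData
    by_cases hws : fwd (q + 1) t ∈ sphere (0 : Fin (q + 1) → ℝ) 1
    · rw [if_pos hws]
      obtain ⟨i, hi⟩ := exists_bwd_eq_zero hws
      have hbw : bwd (q + 1) (fwd (q + 1) t) = t := bwd_fwd t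
      have hti : t i = 0 := by rw [← hbw]; exact hi
      have h := sideData_of_apply_eq_zero hF x₀ t hti 1
      show sideData F x₀ (bwd (q + 1) (fwd (q + 1) t), ((1 : I) : ℝ)) = x₀
      rw [hbw, h, htop]
    · rw [if_neg hws, if_neg (show ¬ ((1 : I) : ℝ) ≤ 1 / 2 by norm_num)]
  · intro i t s
    show Φ (fwd (q + 1) (stdFace i t), (s : ℝ)) = F i (t, s)
    have hws : fwd (q + 1) (stdFace i t) ∈ sphere (0 : Fin (q + 1) → ℝ) 1 :=
      fwd_mem_sphere ⟨i, stdFace_apply_self i t⟩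
    have hb : (fwd (q + 1) (stdFace i t), (s : ℝ)) ∈ BoxExt.boxBoundary (q + 1) :=
      BoxExt.mem_boxBoundary.2 (Or.inr ⟨hws, s.2.1, s.2.2⟩)
    rw [hΦ hb]
    unfold bdryData
    rw [if_pos hws]
    exact sideData'_fwd_stdFace F x₀ hF i t s

end Fill

end SimplexPrism

end Literature.AlgebraicTopology.Homotopy

end
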